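import Mathlib
import HarnessLib
import Summits.Langlands.Langlands.Theses.TameTypeSwitch
import Literature.NumberTheory.PAdicHodge.CrystallineBaseChange
import Literature.NumberTheory.PAdicHodge.LabelledHodgeTateWeightsBaseChangeLabelwise
import Literature.NumberTheory.PAdicHodge.FontaineDpst
import Literature.NumberTheory.GaloisRepresentations.ToLocalRestrictField
import Literature.NumberTheory.GaloisRepresentations.PadicAlgebraOfLocalField
import Literature.NumberTheory.GaloisRepresentations.InducedAEUnramified
import Summits.Langlands.Langlands.Theorems.StickelbergerDialUnramifiedFermatWitnessStubResidualBundleRestrictField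

/-!
# Birth skeleton for crux stmt-Langlands-18269
`Summit.Langlands.Langlands.Theses.TameTypeSwitch.TameTypedWitness` — line `birth`

Route `route-Langlands-TameTypeSwitch` (`closes (hW : TameTypedWitness) (hL : TypedWitnessFLLifting)
(hJ : SectorComplement) (hA : Assembly) : Langlands`; this crux is `hW`, rank 2, "THE DOOR").

THE CRUX: for `K` CM, `K^{av}/K` finite, `n ≥ 2`, a bound `B`, a prime `ℓ > n²` with `2B + 2 < ℓ`
unramified in `K`, `ι : ℚ̄_ℓ ≃ ℂ`, `r : Γ_K → GL_n(ℚ̄_ℓ)` a.e. unramified, crystalline at every `v ∣ ℓ`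
(THE pinned datum `fontainePstAdicCompletion v ℓ hv`) with REGULAR labelled Hodge–Tate weights in `[0,B]`,
and a residual representation `τ` (absolutely irreducible, decomposed generic, absolutely irreducible and
enormous on `Γ_{K(ζ_ℓ)}`, scalar somewhere off it), there are a finite Galois CM `K'/K`, linearly
disjoint from `K^{av}`, with `ℓ` unramified in `K'`, the transported analytic hypotheses for `r|_{Γ_{K'}}`,
a residual representation `τ'` of `r|_{Γ_{K'}}` with the same four residual properties, and a TYPED
WITNESS: a weight-`0` cuspidal `π` of `GL_n(𝔸_{K'})` with a non-zero `K(𝔫·ℓ)`-fixed vector (`𝔫` prime to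
`ℓ`; depth zero above `ℓ`) and a framed `r₀` with the Satake–Frobenius property of `r_ι(π)` reducing to `τ'`.

## The cut (three stubs, all load-bearing; composition kernel-checked)

The crux is cut along the seams separating its ARITHMETIC content from Galois / `p`-adic-Hodge
bookkeeping — the pattern that survived triage on the sibling crux `StickelbergerDial.UnramifiedFermatWitness`
(line `Sketch`), adapted to the two features that are NEW here: the witness is TYPED (depth-zero level at
`ℓ`, not unramified) and the weights are an arbitrary regular multiset in `[0,B]` VARYING WITH THE LABEL
(so the uniform-`S` base change `LabelledHodgeTateWeightsBaseChange` does not suffice: the label-by-label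
fact is needed).

* `stub_tameTypedResidualAutomorphy` (S1, XL — THE DOOR PROPER, said openly): under the crux's hypotheses on
  `(K, K^{av}, n, B, ℓ, ι, r, τ)` MINUS the three `Γ_{K(ζ_ℓ)}`-clauses and a.e.-unramifiedness (not used by a
  potential-automorphy argument) and for ANY second finite extension `L/K` to avoid, there is a finite Galois
  CM `K'/K`, linearly disjoint from `K^{av}` and from `L`, with `ℓ` unramified in `K'`, over which
  `τ' := τ ∘ res_{K'/K}` is decomposed generic and RESIDUALLY AUTOMORPHIC BY A TYPED WEIGHT-ZERO WITNESS:
  `hcpt'`, a weight-`0` cuspidal `π`, a framed `r₀` with the Satake–Frobenius property of `r_ι(π)` at every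
  place above every rational `q ≠ ℓ` above which `π` is unramified, `r₀` residually `τ'`, and a non-zero
  `K(𝔫·ℓ)`-fixed vector of `π` modulo `W'`, `𝔫` prime to `ℓ`.  Its conclusion does not mention `r` and
  carries none of the seven transported clauses of the crux.  Paper route (route header, § Mechanism):
  a digit lemma placing the Fontaine–Laffaille exponents of `τ|_{G_{K_v}}` (`v ∣ ℓ`, `K_v/ℚ_ℓ` unramified,
  `2B+2 < ℓ`) among the mod-`ℓ` fibres of a descended non-self-dual hypergeometric local system of level
  `N ∣ ℓ^f − 1` at TAME points over an UNRAMIFIED extension of `K_v` (Katz ESDE Ch. 8; Beukers–Cohen–Mellit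
  finite hypergeometric traces), big mod-`ℓ` and mod-`ℓ'` monodromy (Katz ESDE 8.11; Guralnick–Harris–Katz),
  Moret-Bailly with the places above `ℓ` prescribed unramified and `K'` kept CM and linearly disjoint from
  `K^{av}·L` (BLGGT Prop. 3.1.1; BCGNT arXiv:2309.15880 Prop. 4.5.1), decomposed genericity of `τ|_{Γ_{K'}}`
  by linear disjointness over `ℚ` (ACC+ Lemma 7.1.7 = arXiv:1812.09999 Lemma 136), automorphy of the fibre
  by Qian's `ℓ'`-switch (Qian Thm. 1.4) and the depth-zero level at `w ∣ ℓ` from the tame type of the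
  `ℓ'`-adic realisation by local–global compatibility at `w ∤ ℓ'` (Varma) — none of these engines is in the
  tree (no Moret-Bailly, no hypergeometric sheaves, no compatible system of a motive, no `r_ι(π)`).
  Why it might fail = the crux's: mod-`ℓ` monodromy of level-`N` (`N > ℓ`) sheaves too small for the
  twisted moduli space to be geometrically irreducible; non-semisimple `τ|_{G_{K_v}}` unreachable by tame points.
* `stub_crystallineBaseChange` (S2, M — LOCAL `p`-adic Hodge theory): literally the accepted unproved named
  fact `Literature.NumberTheory.PAdicHodge.CrystallineBaseChange` (crystallinity for THE pinned data
  `fontainePst` is insensitive to a continuous finite extension of the `ℓ`-adic base; Fontaine Exp. VIII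
  §2.3.7; blocked on definition item `defn-FontainePstWeilDeligneData`: the Weil–Deligne half of the pin).
* `stub_labelledWeightsBaseChangeLabelwise` (S3, M — LOCAL, label by label): literally the accepted unproved
  named fact `Literature.NumberTheory.PAdicHodge.LabelledHodgeTateWeightsBaseChangeLabelwise`
  (`HT_{τ''}(ρ|_{Γ_L}) = HT_{τ''|_K}(ρ)`, Brinon–Conrad Prop. 6.3.8; Patrikis §2.7.1).  Since
  `DeRhamBaseChange_holds` (the `Γ`-equivariant `ℚ_ℓ`-linear `B_dR(K) ≃ B_dR(L)`, `exists_fracBdR_ringEquiv`)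
  landed, what is missing is the FILTERED comparison and the label splitting `L ⊗_K D_{τ'} = ⊕ D_{τ''}`.

PROVED HERE (not stubs): `adicCompletionOfLiesOver_algebraMap_pinned` (the local base-change map
`K_v → K'_w` intertwines the pinned `ℚ_ℓ`-structures: both are the unique continuous ones,
`fontainePstAdicCompletion_algebra_eq_adicCompletionPadicAlgebra`, `eq_algebraMap_adicCompletionPadicAlgebra`);
`labelledWeights_restrictField_of_labelwise` (ANY property of the labelled multisets holding at every label
of every `v ∣ ℓ` holds at every label of every `w ∣ ℓ` after restriction to `Γ_{K'}` — from S3 through the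
accepted global plumbing `labelledHodgeTateWeightsAt_restrictField_eq_comp_of_liesOver`, the restricted label
being made a `ℚ_ℓ`-algebra map by the previous lemma); and the composition
`TameTypedWitness_of : S1 → S2 → S3 → TameTypedWitness` — control field `L` from the LANDED sibling theorem
`Summit.Langlands.Langlands.Theorems.UnramifiedFermatWitness.stub_residualBundle_restrictField` (p159413:
the residual bundle — residual representation of `r|_{Γ_{K'}}`, absolute irreducibility, the two
`Γ_{K'(ζ_ℓ)}`-clauses and the scalar element — transports to `τ ∘ res` for every `K'` linearly disjoint from
`L`), the field `K'` and the typed witness from S1 (avoiding `K^{av}` and `L`), a.e.-unramifiedness by the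
accepted `FramedGaloisRep.eventually_isUnramifiedAt_restrictField`, crystallinity by S2 through the accepted
`isCrystallineFramed_toLocal_restrictField`, and the regular-in-`[0,B]` weights by S3 through
`labelledWeights_restrictField_of_labelwise`.  The conclusion is the route decl BY NAME.

Disproof used: none exists for this crux (no `Cruxes/TameTypedWitness/` directory at registration time);
the sibling's Disproof verdict ("`K' = K` reduces the door to Serre-type residual automorphy over `K` itself")
is NOT used as a cut here — it would register the generalised Serre conjecture as the stub (costume for a
registrar); S1 keeps the field extension, which is where the tame mechanism earns `ℓ`-unramifiedness.
Dead lines avoided: the `V`-split formulation of the door (Moret-Bailly cannot split externally given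
primes while realising local conditions at them) and "decomposed genericity transports along any `K'`
linearly disjoint from a control field" (false: needs disjointness over `ℚ`, ACC+ Lemma 136) — S1 delivers
decomposed genericity of `τ ∘ res` itself, as the printed Moret-Bailly step does.
`ledger negatives --problem Langlands`: no stub restates a typed refutation.
-/

set_option linter.dupNamespace false

noncomputable section

namespace Summit.Langlands.Langlands.Cruxes.TameTypedWitness.Birth

open Summit.Langlands.Langlands.Theses.TameTypeSwitch
open Filter IsDedekindDomain NumberField Field
open Literature.NumberTheory.GaloisRepresentations Literature.NumberTheory.PAdicHodge
open Literature.NumberTheory.Automorphic (adicCompletionOfLiesOver continuous_adicCompletionOfLiesOver)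
-- `Classical`: the place subtypes indexing `mixedSpace K'` are `Fintype` classically
-- (`NormedCommRing (mixedSpace K')`, needed to write `π.1.W`), as in the route file.
open scoped TensorProduct NumberField Classical

/-! ## 0. Plumbing (proved, not stubs) -/

/-- **The local base-change map `K_v → K'_w` (`w ∣ v ∣ ℓ`) intertwines the pinned `ℚ_ℓ`-structures** of
`fontainePstAdicCompletion v ℓ hv` and `fontainePstAdicCompletion w ℓ hw`: both are the canonical
structures (`fontainePstAdicCompletion_algebra_eq_adicCompletionPadicAlgebra`), and a continuous ring map
`ℚ_ℓ → K'_w` is unique (`LocalField.eq_algebraMap_adicCompletionPadicAlgebra`). [folklore] -/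
theorem adicCompletionOfLiesOver_algebraMap_pinned {K K' : Type} [Field K] [NumberField K] [Field K']
    [NumberField K'] [Algebra K K'] {ℓ : ℕ} [Fact ℓ.Prime] (v : HeightOneSpectrum (𝓞 K))
    (w : HeightOneSpectrum (𝓞 K')) [w.asIdeal.LiesOver v.asIdeal] (hv : ((ℓ : ℕ) : 𝓞 K) ∈ v.asIdeal)
    (hw : ((ℓ : ℕ) : 𝓞 K') ∈ w.asIdeal) (q : ℚ_[ℓ]) :
    adicCompletionOfLiesOver K K' v w
        ((letI := (fontainePstAdicCompletion v ℓ hv).algebra; algebraMap ℚ_[ℓ] (v.adicCompletion K)) q) =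
      (letI := (fontainePstAdicCompletion w ℓ hw).algebra; algebraMap ℚ_[ℓ] (w.adicCompletion K')) q := by
  rw [fontainePstAdicCompletion_algebra_eq_adicCompletionPadicAlgebra v ℓ hv,
    fontainePstAdicCompletion_algebra_eq_adicCompletionPadicAlgebra w ℓ hw]
  have h := LocalField.eq_algebraMap_adicCompletionPadicAlgebra w ℓ hw
    ((adicCompletionOfLiesOver K K' v w).comp
      (letI := LocalField.adicCompletionPadicAlgebra v ℓ hv; algebraMap ℚ_[ℓ] (v.adicCompletion K)))
    ((continuous_adicCompletionOfLiesOver K K' v w).comp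
      (LocalField.continuous_algebraMap_adicCompletionPadicAlgebra v ℓ hv))
  exact RingHom.congr_fun h q

/-- **A label-wise property of the Hodge–Tate multisets restricts along `K'/K`** (for THE pinned data of
the places, modulo the LOCAL label-by-label base change S3): if `P (HT_{τ'}(r|_{Γ_{K_v}}))` for every
`v ∣ ℓ` and every `ℚ_ℓ`-label `τ'` of `K_v`, then `P (HT_{τ''}((r|_{Γ_{K'}})|_{Γ_{K'_w}}))` for every
`w ∣ ℓ` and every `ℚ_ℓ`-label `τ''` of `K'_w` — because that multiset IS `HT_{τ'' ∘ (K_v → K'_w)}(r|_{Γ_{K_v}})`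
for `v = w ∩ 𝓞 K` (accepted `labelledHodgeTateWeightsAt_restrictField_eq_comp_of_liesOver`) and the restricted
label is a `ℚ_ℓ`-label of `K_v` (`adicCompletionOfLiesOver_algebraMap_pinned`).  Used with
`P M := M.Nodup ∧ ∀ h ∈ M, 0 ≤ h ≤ B`. [cite: BrinonConrad2009, Prop. 6.3.8] [cite: Patrikis2019, §2.7.1] -/
theorem labelledWeights_restrictField_of_labelwise (h₃ : LabelledHodgeTateWeightsBaseChangeLabelwise)
    {K : Type} [Field K] [NumberField K] (K' : Type) [Field K'] [NumberField K'] [Algebra K K']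
    {ℓ : ℕ} [Fact ℓ.Prime] {n : ℕ} (r : FramedGaloisRep K (PadicAlgCl ℓ) n) (P : Multiset ℤ → Prop)
    (hP : ∀ (v : HeightOneSpectrum (𝓞 K)) (hv : ((ℓ : ℕ) : 𝓞 K) ∈ v.asIdeal),
      letI := (fontainePstAdicCompletion v ℓ hv).algebra
      ∀ τ' : v.adicCompletion K →ₐ[ℚ_[ℓ]] PadicAlgCl ℓ,
        P (r.labelledHodgeTateWeightsAt v (fontainePstAdicCompletion v ℓ hv).algebra
          (fontainePstAdicCompletion v ℓ hv).𝔅 τ'.toRingHom))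
    (w : HeightOneSpectrum (𝓞 K')) (hw : ((ℓ : ℕ) : 𝓞 K') ∈ w.asIdeal) :
    letI := (fontainePstAdicCompletion w ℓ hw).algebra
    ∀ τ'' : w.adicCompletion K' →ₐ[ℚ_[ℓ]] PadicAlgCl ℓ,
      P ((r.restrictField K').labelledHodgeTateWeightsAt w (fontainePstAdicCompletion w ℓ hw).algebra
        (fontainePstAdicCompletion w ℓ hw).𝔅 τ''.toRingHom) := by
  haveI := liesOver_under (F := K) w
  have hv : ((ℓ : ℕ) : 𝓞 K) ∈ (w.under (𝓞 K)).asIdeal :=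
    (natCast_mem_asIdeal_iff_of_liesOver (w.under (𝓞 K)) w ℓ).1 hw
  letI := (fontainePstAdicCompletion w ℓ hw).algebra
  intro τ''
  rw [labelledHodgeTateWeightsAt_restrictField_eq_comp_of_liesOver h₃ r (w.under (𝓞 K)) w hv hw τ'']
  letI := (fontainePstAdicCompletion (w.under (𝓞 K)) ℓ hv).algebra
  -- the restricted label `τ'' ∘ (K_v → K'_w)` is a `ℚ_ℓ`-label of `K_v` for the pinned structure
  let τ₁ : (w.under (𝓞 K)).adicCompletion K →ₐ[ℚ_[ℓ]] PadicAlgCl ℓ :=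
    ⟨τ''.toRingHom.comp (adicCompletionOfLiesOver K K' (w.under (𝓞 K)) w), fun q => by
      change τ'' (adicCompletionOfLiesOver K K' (w.under (𝓞 K)) w
          (algebraMap ℚ_[ℓ] ((w.under (𝓞 K)).adicCompletion K) q)) = algebraMap ℚ_[ℓ] (PadicAlgCl ℓ) q
      have e : adicCompletionOfLiesOver K K' (w.under (𝓞 K)) w
            (algebraMap ℚ_[ℓ] ((w.under (𝓞 K)).adicCompletion K) q) =
          algebraMap ℚ_[ℓ] (w.adicCompletion K') q :=
        adicCompletionOfLiesOver_algebraMap_pinned (w.under (𝓞 K)) w hv hw q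
      rw [e]
      exact τ''.commutes q⟩
  exact hP (w.under (𝓞 K)) hv τ₁

/-! ## 1. The three stubs -/

/-- **STUB S1 — ℓ-UNRAMIFIED POTENTIAL RESIDUAL AUTOMORPHY BY A TYPED WEIGHT-ZERO WITNESS, avoiding two
prescribed finite extensions** (THE DOOR PROPER of the crux; everything else is transport).  Let `K` be a CM
number field, `K^{av}/K` and `L/K` finite, `n ≥ 2`, `B` a bound, `ℓ > n²` a prime with `2B + 2 < ℓ`
unramified in `K`, `ι : ℚ̄_ℓ ≃ ℂ`, `r : Γ_K → GL_n(ℚ̄_ℓ)` framed, crystalline at every `v ∣ ℓ` for THE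
pinned datum `fontainePstAdicCompletion v ℓ hv` with pairwise distinct labelled Hodge–Tate weights in
`[0,B]` at every label, and `τ : Γ_K → GL_n(𝔽̄_ℓ)` a residual representation of `r` which is absolutely
irreducible and decomposed generic.  Then there are a number field `K'`, Galois and CM over `K`, linearly
disjoint from `K^{av}` and from `L` over `K`, with `ℓ` unramified in `K'`, a compactness witness `hcpt'`, a
cuspidal `π` of `GL_n(𝔸_{K'})` and a framed `r₀ : Γ_{K'} → GL_n(ℚ̄_ℓ)` such that, with
`τ' := τ ∘ absGaloisRestrict K K'`: `τ'` is decomposed generic; `π` has weight `0`; `r₀` has the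
Satake–Frobenius property of `r_ι(π)` (at every place above every rational `q ≠ ℓ` above which `π` is
unramified, `r₀` is unramified with the Frobenius characteristic polynomial predicted by the Satake
parameter); `τ'` is a residual representation of `r₀`; and `π` has DEPTH ZERO ABOVE `ℓ`: a form
`φ ∈ W ∖ W'` fixed by the principal congruence subgroup `K(𝔫·ℓ)` for some non-zero `𝔫` prime to `ℓ`.
Paper route (route header): tame Moret-Bailly points of descended non-self-dual hypergeometric families
(`N ∣ ℓ^f − 1`, parameters `a_j ≡` the Fontaine–Laffaille exponents of `τ|_{G_{K_v}}` by the digit lemma,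
tame points over UNRAMIFIED extensions of `K_v`), places above `ℓ` prescribed unramified and `K'` CM,
linearly disjoint from `K^{av}·L` (BLGGT Prop. 3.1.1 / BCGNT Prop. 4.5.1), decomposed genericity by linear
disjointness over `ℚ` (ACC+ Lemma 7.1.7), automorphy of the fibre by the `ℓ'`-switch (Qian Thm. 1.4), the
depth-zero level at `w ∣ ℓ` read off the tame `ℓ'`-adic realisation by local–global compatibility at
`w ∤ ℓ'`.  Not provable in the tree today (no Moret-Bailly, no hypergeometric local systems, no compatible
system attached to a motive or to a cuspidal `π`); it is the crux's entire arithmetic content.  Why it might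
fail: the mod-`ℓ` monodromy of level-`N` (`N > ℓ`) sheaves may be too small for the twisted moduli space to
be geometrically irreducible, and a non-semisimple `τ|_{G_{K_v}}` may be unreachable by tame points.
[cite: Qian2022, Thm. 1.4] [cite: BarnetlambEtAl2014, Prop. 3.1.1] [cite: Katz1990ESDE, Ch. 8, 8.11]
[cite: ACCGHLNSTT2023, Lemma 7.1.7 and §6.5.12] [cite: BoxerEtAl2023, Prop. 4.5.1] -/
theorem stub_tameTypedResidualAutomorphy :
    ∀ (K : Type) [Field K] [NumberField K], NumberField.IsCMField K →
    ∀ (Kav : Type) [Field Kav] [Algebra K Kav], FiniteDimensional K Kav →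
    ∀ (n B : ℕ), 2 ≤ n → ∀ (ℓ : ℕ) [Fact ℓ.Prime], n ^ 2 < ℓ → 2 * B + 2 < ℓ →
    Algebra.IsUnramifiedIn (NumberField.RingOfIntegers K) (Ideal.span {(ℓ : ℤ)}) →
    ∀ (ι : PadicAlgCl ℓ ≃+* ℂ)
      (r : Literature.NumberTheory.GaloisRepresentations.FramedGaloisRep K (PadicAlgCl ℓ) n)
      (τ : Field.absoluteGaloisGroup K →* GL (Fin n)
        (Literature.NumberTheory.GaloisRepresentations.padicAlgClResidueField ℓ)),
    (∀ (v : IsDedekindDomain.HeightOneSpectrum (NumberField.RingOfIntegers K))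
        (hv : (ℓ : NumberField.RingOfIntegers K) ∈ v.asIdeal),
      let D := Literature.NumberTheory.PAdicHodge.fontainePstAdicCompletion v ℓ hv;
      D.IsCrystallineFramed (r.toLocal v) ∧
        (letI := D.algebra
         ∀ τ' : v.adicCompletion K →ₐ[ℚ_[ℓ]] PadicAlgCl ℓ,
           (r.labelledHodgeTateWeightsAt v D.algebra D.𝔅 τ'.toRingHom).Nodup ∧
             ∀ h ∈ r.labelledHodgeTateWeightsAt v D.algebra D.𝔅 τ'.toRingHom, 0 ≤ h ∧ h ≤ (B : ℤ))) →
    r.IsResidualRepOf (RingHom.id _) τ →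
    Literature.NumberTheory.GaloisRepresentations.IsAbsIrreducible τ →
    Literature.NumberTheory.GaloisRepresentations.IsDecomposedGeneric τ →
    ∀ (L : Type) [Field L] [Algebra K L], FiniteDimensional K L →
    ∃ (K' : Type) (_ : Field K') (_ : NumberField K') (_ : Algebra K K'),
      IsGalois K K' ∧ NumberField.IsCMField K' ∧ IsField (TensorProduct K Kav K') ∧
      IsField (TensorProduct K L K') ∧
      Algebra.IsUnramifiedIn (NumberField.RingOfIntegers K') (Ideal.span {(ℓ : ℤ)}) ∧
      ∃ (hcpt' : Literature.NumberTheory.Automorphic.isCompact_glFiniteIntegralLevel n K')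
        (π : Literature.NumberTheory.Automorphic.CuspidalAutomorphicRepData n K' hcpt')
        (r₀ : Literature.NumberTheory.GaloisRepresentations.FramedGaloisRep K' (PadicAlgCl ℓ) n),
        Literature.NumberTheory.GaloisRepresentations.IsDecomposedGeneric
            (τ.comp (Literature.NumberTheory.GaloisRepresentations.absGaloisRestrict K K').toMonoidHom) ∧
        π.1.HasWeightZero ∧
        (∀ q : ℕ, q.Prime → q ≠ ℓ →
          (∀ w : IsDedekindDomain.HeightOneSpectrum (NumberField.RingOfIntegers K'),
            (q : NumberField.RingOfIntegers K') ∈ w.asIdeal → π.1.IsUnramifiedAt w) →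
          ∀ v : IsDedekindDomain.HeightOneSpectrum (NumberField.RingOfIntegers K'),
            (q : NumberField.RingOfIntegers K') ∈ v.asIdeal → ∀ α : Multiset ℂ,
              π.1.HasSatakeParamAt v α →
                r₀.IsUnramifiedAt v ∧ r₀.HasFrobCharpolyAt v
                  (Literature.NumberTheory.Automorphic.arithFrobPolyOfSatake ι v.residueCard n α)) ∧
        r₀.IsResidualRepOf (RingHom.id _)
            (τ.comp (Literature.NumberTheory.GaloisRepresentations.absGaloisRestrict K K').toMonoidHom) ∧
        ∃ 𝔫 : Ideal (NumberField.RingOfIntegers K'), 𝔫 ≠ 0 ∧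
          (∀ w : IsDedekindDomain.HeightOneSpectrum (NumberField.RingOfIntegers K'),
            (ℓ : NumberField.RingOfIntegers K') ∈ w.asIdeal → ¬ w.asIdeal ∣ 𝔫) ∧
          ∃ φ ∈ π.1.W, φ ∉ π.1.W' ∧
            ∀ u ∈ Literature.NumberTheory.Automorphic.principalCongruenceLevel n K'
                (𝔫 * Ideal.span {(ℓ : NumberField.RingOfIntegers K')}),
              Literature.NumberTheory.Automorphic.rightTranslation
                (Literature.NumberTheory.Automorphic.AdelicGroupData.gl n K') u φ = φ := by
  sorry

/-- **STUB S2 — crystallinity for THE pinned Fontaine data is insensitive to a finite extension of the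
`ℓ`-adic base field** (LOCAL base change; literally the accepted unproved named fact
`Literature.NumberTheory.PAdicHodge.CrystallineBaseChange`, whose docstring records the status: TRUE of
Fontaine's genuine `(B_dR, D_pst)` — `B_cris`-admissibility restricts to `Γ_L` — but formally unreachable
until the Weil–Deligne half of `fontainePst` is the construction `WD ∘ D_pst`, definition item
`defn-FontainePstWeilDeligneData`).  Shape = hypothesis `hcr` of the accepted plumbing
`isCrystallineFramed_toLocal_restrictField`, quantified over `ℓ`.  Shared verbatim with stub S3a of the
sibling crux `StickelbergerDial.UnramifiedFermatWitness` (one discharge closes both).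
[cite: FontaineAsterisque223VIII, §2.3.7] [cite: FontaineAsterisque223III, Exp. III §5.1]
[cite: BrinonConrad2009, §9.1 and Prop. 6.3.8] -/
theorem stub_crystallineBaseChange : Literature.NumberTheory.PAdicHodge.CrystallineBaseChange := by
  sorry

/-- **STUB S3 — the labelled Hodge–Tate weights for THE pinned Fontaine data under finite base change,
LABEL BY LABEL**: `HT_{τ''}(ρ|_{Γ_L}) = HT_{τ'' ∘ (K → L)}(ρ)` for a continuous embedding `K → L` of
`ℓ`-adic local fields and every `ℚ_ℓ`-label `τ''` of `L` (literally the accepted unproved named fact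
`Literature.NumberTheory.PAdicHodge.LabelledHodgeTateWeightsBaseChangeLabelwise`; Brinon–Conrad Prop. 6.3.8,
`L ⊗_K D_{dR,K}(V) ≅ D_{dR,L}(V)` in `Fil_L`; Patrikis §2.7.1).  Needed label-wise (not in the uniform-`S`
form `LabelledHodgeTateWeightsBaseChange` of the sibling) because the crux's weights are an arbitrary
regular multiset in `[0,B]` depending on the label.  Provable in principle today: the period rings ARE
`bdRPeriodRingData` and the `Γ`-equivariant `ℚ_ℓ`-linear `B_dR(K) ≃ B_dR(L)` exists
(`exists_fracBdR_ringEquiv`, used by `DeRhamBaseChange_holds`); missing are the FILTERED comparison and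
the label splitting `L ⊗_K D_{τ'} ≅ ⊕_{τ''|_K = τ'} D_{τ''}`.
[cite: BrinonConrad2009, Prop. 6.3.8] [cite: Patrikis2019, §2.7.1]
[cite: FontaineAsterisque223III, Exp. III §1.5 and §3] -/
theorem stub_labelledWeightsBaseChangeLabelwise :
    Literature.NumberTheory.PAdicHodge.LabelledHodgeTateWeightsBaseChangeLabelwise := by
  sorry

/-! ## 2. The stub statements as named propositions -/

namespace _Goal

/-- The statement of `stub_tameTypedResidualAutomorphy` (literally its type). [folklore] -/
def stub_tameTypedResidualAutomorphy : Prop :=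
  type_of% @Summit.Langlands.Langlands.Cruxes.TameTypedWitness.Birth.stub_tameTypedResidualAutomorphy

/-- The statement of `stub_crystallineBaseChange` (literally its type). [folklore] -/
def stub_crystallineBaseChange : Prop :=
  type_of% @Summit.Langlands.Langlands.Cruxes.TameTypedWitness.Birth.stub_crystallineBaseChange

/-- The statement of `stub_labelledWeightsBaseChangeLabelwise` (literally its type). [folklore] -/
def stub_labelledWeightsBaseChangeLabelwise : Prop :=
  type_of% @Summit.Langlands.Langlands.Cruxes.TameTypedWitness.Birth.stub_labelledWeightsBaseChangeLabelwise

end _Goal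

/-! ## 3. The composition (kernel-checked, no `sorry`) -/

/-- **`TameTypedWitness` from the three stubs.**  Given the crux's data and hypotheses: the LANDED
`Summit.Langlands.Langlands.Theorems.UnramifiedFermatWitness.stub_residualBundle_restrictField` (p159413)
provides a control field `L/K`; S1 a finite Galois CM `K'/K`, linearly disjoint from `K^{av}` and from `L`,
with `ℓ` unramified in `K'`, together with `hcpt'`, the typed witness `(π, r₀, 𝔫, φ)` and decomposed
genericity of `τ' := τ ∘ res_{K'/K}`; the landed theorem again (fed the disjointness from `L`) the rest of
the residual bundle for `τ'`; a.e.-unramifiedness of `r|_{Γ_{K'}}` is the accepted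
`FramedGaloisRep.eventually_isUnramifiedAt_restrictField`; crystallinity at `w ∣ ℓ` is S2 through the
accepted `isCrystallineFramed_toLocal_restrictField`; the regular-in-`[0,B]` labelled weights are S3 through
`labelledWeights_restrictField_of_labelwise`.  The conclusion is the route decl BY NAME. [folklore] -/
theorem TameTypedWitness_of (h₁ : _Goal.stub_tameTypedResidualAutomorphy)
    (h₂ : _Goal.stub_crystallineBaseChange) (h₃ : _Goal.stub_labelledWeightsBaseChangeLabelwise) :
    Summit.Langlands.Langlands.Theses.TameTypeSwitch.TameTypedWitness := by
  unfold _Goal.stub_tameTypedResidualAutomorphy at h₁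
  unfold _Goal.stub_crystallineBaseChange at h₂
  unfold _Goal.stub_labelledWeightsBaseChangeLabelwise at h₃
  intro K _ _ hK Kav _ _ hKav n B hn ℓ _ hnℓ hBℓ hunr k ι r τ hae hcris hres habs hdg H habsH hen hσ
  -- the control field of `τ` (landed theorem of the sibling crux)
  obtain ⟨L, iFL, iAL, hfdL, hL⟩ :=
    Summit.Langlands.Langlands.Theorems.UnramifiedFermatWitness.stub_residualBundle_restrictField
      K n ℓ r τ hres habs habsH hen hσ
  -- S1: the ℓ-unramified CM field `K'` avoiding `Kav` and `L`, with the typed weight-zero witness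
  obtain ⟨K', iF, iN, iA, hgal, hcm, hdisj, hdisjL, hunr', hcpt', π, r₀, hdg', hwt, hcomp, hres₀, hlev⟩ :=
    h₁ K hK Kav hKav n B hn ℓ hnℓ hBℓ hunr ι r τ hcris hres habs hdg L hfdL
  -- the residual bundle over `K'`
  obtain ⟨hres', habs', habsH', hen', hσ'⟩ := hL K' hdisjL
  refine ⟨K', iF, iN, iA, hgal, hcm, hdisj, hunr', hcpt', _, π, r₀,
    r.eventually_isUnramifiedAt_restrictField hae, ?_, hres', habs', hdg', habsH', hen', hσ',
    hwt, hcomp, hres₀, hlev⟩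
  -- the analytic clauses at `w ∣ ℓ`: S2 (crystalline) and S3 (labelled weights), transported
  intro w hw
  exact ⟨isCrystallineFramed_toLocal_restrictField (h₂ ℓ) r (fun v hv => (hcris v hv).1) w hw,
    labelledWeights_restrictField_of_labelwise h₃ K' r
      (fun M => M.Nodup ∧ ∀ h ∈ M, 0 ≤ h ∧ h ≤ (B : ℤ)) (fun v hv => (hcris v hv).2) w hw⟩

/-- By-name sanity check: the stubs feed the composition as they stand. -/
example : Summit.Langlands.Langlands.Theses.TameTypeSwitch.TameTypedWitness :=
  TameTypedWitness_of stub_tameTypedResidualAutomorphy stub_crystallineBaseChange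
    stub_labelledWeightsBaseChangeLabelwise

end Summit.Langlands.Langlands.Cruxes.TameTypedWitness.Birth

end
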